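import Summits.QuantumFields.YangMills.Theorems.UnitScaleTiltProp7MassiveSolutionGradientSupOfRegPr
import HarnessLib

/-!
# Route `UnitScaleTilt`, crux K1 «MinimiserStabilityRegPr» (stmt-QuantumFields-19200), EX row `norm_G`, N6 FILE D letters (cκ) — **(W1) THE WEIGHTED BLOCK CONVOLUTION:
# A ONE-BLOCK DECAYED SUP LETTER OF ANY LINEAR `A` CONVOLVES A SOURCE DECAYING FROM A BLOCK `z` INTO AN OUTPUT DECAYING FROM `z` AT THE SAME RATE**, instantiated BY NAME
# at the LOD propagator `G_a` (VAL-κ: `hGsupW_of_regPr`) and at its penalty `a·TιQ″G_a` (PEN-κ: `hpenW_of_regPr`) — the κ-weighted twins of px12 g16's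
# ✓`Prop7MassiveSolutionGradientSupOfRegPr.hGsup_of_regPr` ∕ `norm_equiv_penalty_solution_le_of_sup` (★p1 g27 CHAIR WORD №30 (2) «(cκ) the κ-WEIGHTED (c)-package»;
# width seat `ym3-torus-px5` gen 14, successor of px5 g13 who priced the road «VAL-κ → SRC-κ → T1-κ → KNIT-κ»).

Cell `ym3-torus` (HUMAN RULING D-0037; rung R3 = SU(2) YM₃ on T³ — NOT d = 4, NOT infinite volume, NOT a mass gap, NOT Clay).  THEOREMS ONLY (0 `def`, 0 `sorry`, default heartbeats);
`--supports stmt-QuantumFields-19200 --as helper`; count-neutral.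

THE MATHEMATICS ([Balaban1985BackgroundPropagators] Thm 3.1 (3.42), (3.46) p.398: «the kernels decay as `e^{−δ₀d(y,y′)}` in the scaled distance of the blocks»; the Agmon-weighted
bootstrap of N6 FILE D needs the operator letters on sources that themselves decay from a block `z`).  Let `A` be ℂ-linear on the member's site space with the ONE-BLOCK letter
`‖(A g)(x₀)‖ ≤ B_blk·‖g‖_∞·e^{−δ₀·tdist(B x₀, v)}` for every `g` supported in the block `B(v)`.  For a source with `‖f(x)‖ ≤ F_b·e^{−κ·tdist(B x, z)}`, `0 ≤ κ < δ₀`, cut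
`f = Σ_v f_v` into blocks (✓`sum_blockCut_eq`); `‖f_v‖_∞ ≤ F_b·e^{−κ·tdist(v, z)}`; by the coarse triangle inequality `e^{−δ₀·tdist(B x₀, v)}·e^{−κ·tdist(v, z)} ≤
e^{−κ·tdist(B x₀, z)}·e^{−(δ₀−κ)·tdist(B x₀, v)}`, and the coarse exponential volume ✓`sum_exp_neg_mul_tdist_coarse_le` sums the remainder:
`‖(A f)(x₀)‖ ≤ B_blk·(2(1 + 1∕(δ₀ − κ)))³·F_b·e^{−κ·tdist(B x₀, z)}` — RATE-PRESERVING (the output weight is the input weight), so it docks on any display asking for a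
slower output rate `κ′ ≤ κ` by monotonicity.

WHAT IS PROVED (ns `Summit.QuantumFields.YangMills.Theorems.Prop7BlockConvolutionWeightedSup`; member `F`, `n ≤ K`, weight `c₀`; sites read at `siteEquiv F K x`, blocks
`B x = iterBlockOf (K − n) x`).
* §1 `norm_equiv_blockCut_le_of_weighted` (a block cut of a weighted source carries the weight of its block), `exp_tdist_convolution_le` (the rate bookkeeping),
  `blockCut_eq_self_of_support`, `norm_le_of_blockSupport` (`‖g‖ ≤ √(c₀(L^d)^{K−n})·‖g‖_∞` for one-block `g`, ✓`norm_blockCut_le`).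
* §2 ★★★ `norm_equiv_apply_le_of_blockLetter` — THE WEIGHTED BLOCK CONVOLUTION for any linear `A` with a displayed one-block letter `hblk` at rate `δ₀ > κ ≥ 0`.
* §3 ★★ `blockLetter_massiveSolution_of_regPr` — `hblk` for `G_a` at `δ₀ = (min μ ¼)∕2` from V4g ✓`norm_equiv_massiveSolution_apply_le_decay` (two rates merged, the block `L²`
  size inserted); ★★★ **`hGsupW_of_regPr`** — VAL-κ: `‖f(x)‖ ≤ F_b·e^{−κ·tdist(B x, z)}` ⟹ `‖(G_a f)(x)‖ ≤ B_∞^{blk}·(2(1+1∕((min μ ¼)∕2 − κ)))³·F_b·e^{−κ·tdist(B x, z)}`.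
* §4 ★★ `blockLetter_penalty_of_regPr` — `hblk` for the penalty `u ↦ a·T(ι(Q″(G_a u)))` at rate `μ` (V4g ✓`norm_equiv_penalty_solution_le`); ★★★ **`hpenW_of_regPr`** — PEN-κ at every
  `0 ≤ κ < μ`.
HYP-SAT (★★OWNER RULING №42).  `RegPr` (the EX face's standing class), the LOD letters `hseq hι hT hAG` (⟸ ✓`exists_intertwiner_of_regPr`, ✓`exists_massive_inverse`), V4g's Agmon
window `hδ`∕`hwin` (⟸ routeR-w4 ✓`window_delta`∕`window_win` at the pin, K-free `μ(am)`), `0 ≤ κ <` the engine rate (the consumer's choice).  The abstract `hblk` of §2 is a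
real-inequality schema inhabited in §3∕§4 BY NAME.  Conclusions are non-vacuous sup bounds; no `Prop` hypothesis restates them.
HONEST SCOPE.  Summation bookkeeping over landed rows; CONDITIONAL on the displayed letters; nothing of N6 FILE D, `norm_G`, the ten EX rows, EX `stub_existenceMinimalOrbit` or the
crux is proved here; the Yang–Mills mass gap is NOT proved.

References: T. Bałaban, CMP **99** (1985) 389–434 [Balaban1985BackgroundPropagators] (Thm 3.1 (3.42) p.397, (3.45)–(3.46) p.398, (3.49) p.399, (3.24) p.394);
CMP **95** (1984) 17–40 [Balaban1984PropagatorsI] ((1.18) p.20, the blocks `B^k(y)`).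
-/

set_option autoImplicit false

noncomputable section

open scoped BigOperators Matrix.Norms.L2Operator InnerProductSpace ComplexConjugate

namespace Summit.QuantumFields.YangMills.Theorems.Prop7BlockConvolutionWeightedSup

open Literature.MathematicalPhysics.QuantumFieldTheory.Balaban1983to89
open Literature.MathematicalPhysics.QuantumFieldTheory.Balaban1983to89.T3ContinuumYM3Torus
open T4Continuum BlockAveraging
open BlockAveraging (Idx)
open B7Prop1Explicit (disp)
open B5Eq118OneStroke (iterBlockOf iterBlock mem_iterBlock card_iterBlock)
open B10Eq27TorusAxialLog (holT transl)
open B7TransferAnalyticMean (meanCLM)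
open B4Sect5Torus (TSite)
open B9Eq311L2Pairing (WL2)
open B11Eq103H1Complex (SiteL2K)
open Summit.QuantumFields.YangMills.Theorems.Prop8Chart (emlIterU)
open T3SectALandauChart (eta bgUnits)
open T3PrintedRegularMinimiser (RegPr)
open T3PrintedRegularOrbits (sites_eq)
open T3LevelShift (siteShift)
open Summit.QuantumFields.YangMills.Theorems.Prop7SectET3Transport (periodsT3 siteEquiv)
open Summit.QuantumFields.YangMills.Theorems.Prop7SectET3HilbertLetters (W₂ frobEquiv toL2S covLapSite toL2S_apply toL2S_symm_apply)
open Summit.QuantumFields.YangMills.Theorems.Prop7BlockDistanceWeights (sum_exp_neg_mul_tdist_coarse_le tdist_coarse_comm tdist_coarse_triangle)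
open Summit.QuantumFields.YangMills.Theorems.Prop7MassiveSolutionPointwiseDecay (norm_equiv_massiveSolution_apply_le_decay norm_equiv_penalty_solution_le)
open Summit.QuantumFields.YangMills.Theorems.Prop7MassiveSolutionGradientSupOfRegPr (sum_blockCut_eq blockCut_apply_eq_zero norm_blockCut_le)

variable (F : T3Family) {n K : ℕ} (h : n ≤ K) {c₀ c₁ : ℝ} [Fact (0 < c₀)] [Fact (0 < c₁)]
  {ε₀ : ℝ} (hε₀ : 0 < ε₀) (hε7 : 10 ^ 7 * (F.L : ℝ) ^ 3 * ε₀ ≤ 1)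
  (U₀ : GaugeField (F.P K) 0 (Matrix.specialUnitaryGroup (Fin 2) ℂ)) (hreg : RegPr F n K ε₀ U₀)
  (Q'' : SiteL2K ℂ 3 (periodsT3 F K) c₀ W₂ →ₗ[ℂ] (Site (F.P K) (K - n) → Matrix (Fin 2) (Fin 2) ℂ))
  (hseq : ∀ lam : Site (F.P K) 0 → Matrix (Fin 2) (Fin 2) ℂ, ∃ ns : (j : ℕ) → Site (F.P K) j → Matrix (Fin 2) (Fin 2) ℂ, ns 0 = lam ∧
      (∀ (j : ℕ) (y : Site (F.P K) (j + 1)), ns (j + 1) y = ns j (emb y) - meanCLM (Idx (F.P K)) (Matrix (Fin 2) (Fin 2) ℂ) fun i : Idx (F.P K) =>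
        ns j (emb y) - ((holT (emlIterU j (bgUnits F K U₀)) (emb y) (stairWord i.2.1 (off i.1)) : (Matrix (Fin 2) (Fin 2) ℂ)ˣ) : Matrix (Fin 2) (Fin 2) ℂ) *
          ns j (transl (emb y) (disp (stairWord i.2.1 (off i.1)))) * (((holT (emlIterU j (bgUnits F K U₀)) (emb y) (stairWord i.2.1 (off i.1)))⁻¹ : (Matrix (Fin 2) (Fin 2) ℂ)ˣ) : Matrix (Fin 2) (Fin 2) ℂ)) ∧
      ns (K - n) = Q'' (toL2S F K c₀ lam))
  (ι : (Site (F.P K) (K - n) → Matrix (Fin 2) (Fin 2) ℂ) →ₗ[ℂ] SiteL2K ℂ 3 (periodsT3 F n) c₁ W₂)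
  (hι : ∀ c, ι c = toL2S F n c₁ (fun z => c (siteShift (sites_eq F n K h) z)))
  (T : SiteL2K ℂ 3 (periodsT3 F n) c₁ W₂ →ₗ[ℂ] SiteL2K ℂ 3 (periodsT3 F K) c₀ W₂)
  (hT : ∀ (l : SiteL2K ℂ 3 (periodsT3 F K) c₀ W₂) (f : SiteL2K ℂ 3 (periodsT3 F n) c₁ W₂), ⟪ι (Q'' l), f⟫_ℂ = ⟪l, T f⟫_ℂ)
  {a : ℝ} (ha : 0 < a)

/-! ## §1 Weighted block cuts and the rate bookkeeping -/

omit [Fact (0 < c₀)] [Fact (0 < c₁)] in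
/-- **A BLOCK CUT OF A WEIGHTED SOURCE CARRIES THE WEIGHT OF ITS BLOCK**: if `‖f(x)‖ ≤ F_b·e^{−κ·tdist(B x, z)}` for all `x`, then the cut `f_v = toL2S(𝟙_{B(v)}·toL2S⁻¹f)`
satisfies `‖f_v(x)‖ ≤ F_b·e^{−κ·tdist(v, z)}` for all `x`. [folklore] -/
theorem norm_equiv_blockCut_le_of_weighted (f : SiteL2K ℂ 3 (periodsT3 F K) c₀ W₂) (z : Site (F.P K) (K - n)) {Fb κ : ℝ}
    (hf : ∀ x : Site (F.P K) 0, ‖WL2.equiv ℂ _ W₂ f (siteEquiv F K x)‖ ≤ Fb * Real.exp (-(κ * (Site.tdist (iterBlockOf (K - n) x) z : ℝ))))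
    (v : Site (F.P K) (K - n)) :
    ∀ x : Site (F.P K) 0, ‖WL2.equiv ℂ _ W₂ (toL2S F K c₀ (fun x => if iterBlockOf (K - n) x = v then (toL2S F K c₀).symm f x else 0)) (siteEquiv F K x)‖
      ≤ Fb * Real.exp (-(κ * (Site.tdist v z : ℝ))) := by
  intro x
  have hFb0 : 0 ≤ Fb := (mul_nonneg_iff_of_pos_right (Real.exp_pos _)).mp ((norm_nonneg _).trans (hf x))
  rw [toL2S_apply, Equiv.symm_apply_apply]
  by_cases hx : iterBlockOf (K - n) x = v
  · rw [if_pos hx, toL2S_symm_apply, LinearEquiv.symm_apply_apply, ← hx]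
    exact hf x
  · rw [if_neg hx, map_zero, norm_zero]
    positivity

/-- **RATE BOOKKEEPING**: `e^{−δ₀a}·e^{−κb} ≤ e^{−κt}·e^{−(δ₀−κ)a}` whenever `t ≤ a + b` and `0 ≤ κ` (used with `t = tdist(B x₀, z)`, `a = tdist(B x₀, v)`, `b = tdist(v, z)`). [folklore] -/
theorem exp_tdist_convolution_le {a b t κ δ₀ : ℝ} (hκ : 0 ≤ κ) (ht : t ≤ a + b) :
    Real.exp (-(δ₀ * a)) * Real.exp (-(κ * b)) ≤ Real.exp (-(κ * t)) * Real.exp (-((δ₀ - κ) * a)) := by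
  rw [← Real.exp_add, ← Real.exp_add]
  refine Real.exp_le_exp.mpr ?_
  nlinarith [mul_nonneg hκ (sub_nonneg.mpr ht)]

omit [Fact (0 < c₀)] [Fact (0 < c₁)] in
/-- A field supported in the block `B(v)` is its own block cut at `v`. [folklore] -/
theorem blockCut_eq_self_of_support (g : SiteL2K ℂ 3 (periodsT3 F K) c₀ W₂) (v : Site (F.P K) (K - n))
    (hg : ∀ x, iterBlockOf (K - n) x ≠ v → (toL2S F K c₀).symm g x = 0) :
    toL2S F K c₀ (fun x => if iterBlockOf (K - n) x = v then (toL2S F K c₀).symm g x else 0) = g := by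
  conv_rhs => rw [← (toL2S F K c₀).apply_symm_apply g]
  congr 1
  funext x
  by_cases hx : iterBlockOf (K - n) x = v
  · rw [if_pos hx]
  · rw [if_neg hx, hg x hx]

omit [Fact (0 < c₁)] in
/-- **THE `L²` SIZE OF A ONE-BLOCK FIELD**: `‖g‖ ≤ √(c₀·(L^d)^{K−n})·G_b` for `g` supported in `B(v)` with `‖g(x)‖ ≤ G_b` (✓`norm_blockCut_le` at `g = g_v`).
[cite: Balaban1984PropagatorsI, (1.18) p.20] -/
theorem norm_le_of_blockSupport (g : SiteL2K ℂ 3 (periodsT3 F K) c₀ W₂) (v : Site (F.P K) (K - n))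
    (hg : ∀ x, iterBlockOf (K - n) x ≠ v → (toL2S F K c₀).symm g x = 0) {Gb : ℝ}
    (hGb : ∀ x : Site (F.P K) 0, ‖WL2.equiv ℂ _ W₂ g (siteEquiv F K x)‖ ≤ Gb) :
    ‖g‖ ≤ Real.sqrt (c₀ * ((((F.P K).L : ℝ) ^ (F.P K).d) ^ (K - n))) * Gb := by
  have h1 := norm_blockCut_le F g hGb v
  rwa [blockCut_eq_self_of_support F g v hg] at h1

/-! ## §2 ★★★ The weighted block convolution -/

omit [Fact (0 < c₀)] [Fact (0 < c₁)] in
/-- ★★★ **THE WEIGHTED BLOCK CONVOLUTION.**  Let `A` be ℂ-linear on the member site space with the ONE-BLOCK decayed sup letter `hblk` at rate `δ₀`: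
`g ⊂ B(v)`, `‖g(x)‖ ≤ G_b` ⟹ `‖(A g)(x₀)‖ ≤ B_blk·G_b·e^{−δ₀·tdist(B x₀, v)}`.  Then for every source with `‖f(x)‖ ≤ F_b·e^{−κ·tdist(B x, z)}`, `0 ≤ κ < δ₀`, and every `x₀`:
`‖(A f)(x₀)‖ ≤ B_blk·(2(1 + 1∕(δ₀ − κ)))³·F_b·e^{−κ·tdist(B x₀, z)}` — block decomposition, `hblk` per block, ✓`exp_tdist_convolution_le`, ✓`sum_exp_neg_mul_tdist_coarse_le`.
[cite: Balaban1985BackgroundPropagators, Thm 3.1 (3.42) p.397, (3.45)–(3.46) p.398] -/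
theorem norm_equiv_apply_le_of_blockLetter
    (A : SiteL2K ℂ 3 (periodsT3 F K) c₀ W₂ →ₗ[ℂ] SiteL2K ℂ 3 (periodsT3 F K) c₀ W₂) {Bblk δ₀ κ : ℝ} (hBblk : 0 ≤ Bblk) (hκ : 0 ≤ κ) (hκδ : κ < δ₀)
    (hblk : ∀ (g : SiteL2K ℂ 3 (periodsT3 F K) c₀ W₂) (v : Site (F.P K) (K - n)), (∀ x, iterBlockOf (K - n) x ≠ v → (toL2S F K c₀).symm g x = 0) →
      ∀ Gb : ℝ, (∀ x : Site (F.P K) 0, ‖WL2.equiv ℂ _ W₂ g (siteEquiv F K x)‖ ≤ Gb) →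
        ∀ x₀ : Site (F.P K) 0, ‖WL2.equiv ℂ _ W₂ (A g) (siteEquiv F K x₀)‖ ≤ Bblk * Gb * Real.exp (-(δ₀ * (Site.tdist (iterBlockOf (K - n) x₀) v : ℝ))))
    (f : SiteL2K ℂ 3 (periodsT3 F K) c₀ W₂) (z : Site (F.P K) (K - n)) {Fb : ℝ}
    (hf : ∀ x : Site (F.P K) 0, ‖WL2.equiv ℂ _ W₂ f (siteEquiv F K x)‖ ≤ Fb * Real.exp (-(κ * (Site.tdist (iterBlockOf (K - n) x) z : ℝ))))
    (x₀ : Site (F.P K) 0) :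
    ‖WL2.equiv ℂ _ W₂ (A f) (siteEquiv F K x₀)‖
      ≤ Bblk * (2 * (1 + 1 / (δ₀ - κ))) ^ 3 * Fb * Real.exp (-(κ * (Site.tdist (iterBlockOf (K - n) x₀) z : ℝ))) := by
  classical
  have hFb0 : 0 ≤ Fb := (mul_nonneg_iff_of_pos_right (Real.exp_pos _)).mp ((norm_nonneg _).trans (hf x₀))
  have hν : 0 < δ₀ - κ := sub_pos.mpr hκδ
  set g : Site (F.P K) (K - n) → SiteL2K ℂ 3 (periodsT3 F K) c₀ W₂ :=
    fun v => toL2S F K c₀ (fun x => if iterBlockOf (K - n) x = v then (toL2S F K c₀).symm f x else 0) with hg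
  have hsum : ∑ v, g v = f := sum_blockCut_eq F f
  have hAsum : WL2.equiv ℂ _ W₂ (A f) (siteEquiv F K x₀) = ∑ v, WL2.equiv ℂ _ W₂ (A (g v)) (siteEquiv F K x₀) := by
    have e := congrFun (map_sum (WL2.linearEquiv ℂ ℂ (fun _ : TSite 3 (periodsT3 F K) => c₀) (V := W₂)) (fun v => A (g v)) Finset.univ) (siteEquiv F K x₀)
    simp only [WL2.linearEquiv_apply, Finset.sum_apply] at e
    rw [← e, ← map_sum, hsum]
  set E : ℝ := Real.exp (-(κ * (Site.tdist (iterBlockOf (K - n) x₀) z : ℝ))) with hE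
  -- each block's contribution: the one-block letter on the weighted cut, then the rate bookkeeping
  have hterm : ∀ v, ‖WL2.equiv ℂ _ W₂ (A (g v)) (siteEquiv F K x₀)‖
      ≤ Bblk * Fb * E * Real.exp (-((δ₀ - κ) * (Site.tdist (iterBlockOf (K - n) x₀) v : ℝ))) := by
    intro v
    have h1 := hblk (g v) v (blockCut_apply_eq_zero F f v) _ (norm_equiv_blockCut_le_of_weighted F f z hf v) x₀
    have h2 := exp_tdist_convolution_le (δ₀ := δ₀) hκ (tdist_coarse_triangle F (iterBlockOf (K - n) x₀) v z)
    calc _ ≤ Bblk * (Fb * Real.exp (-(κ * (Site.tdist v z : ℝ)))) * Real.exp (-(δ₀ * (Site.tdist (iterBlockOf (K - n) x₀) v : ℝ))) := h1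
      _ = Bblk * Fb * (Real.exp (-(δ₀ * (Site.tdist (iterBlockOf (K - n) x₀) v : ℝ))) * Real.exp (-(κ * (Site.tdist v z : ℝ)))) := by ring
      _ ≤ Bblk * Fb * (E * Real.exp (-((δ₀ - κ) * (Site.tdist (iterBlockOf (K - n) x₀) v : ℝ)))) :=
          mul_le_mul_of_nonneg_left h2 (mul_nonneg hBblk hFb0)
      _ = _ := by ring
  -- the coarse exponential volume at the residual rate `δ₀ − κ`
  have hrow : ∑ v : Site (F.P K) (K - n), Real.exp (-((δ₀ - κ) * (Site.tdist (iterBlockOf (K - n) x₀) v : ℝ))) ≤ (2 * (1 + 1 / (δ₀ - κ))) ^ 3 := by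
    have h' := sum_exp_neg_mul_tdist_coarse_le F (n := n) (K := K) hν (iterBlockOf (K - n) x₀)
    refine le_of_eq_of_le (Finset.sum_congr rfl fun v _ => ?_) h'
    rw [tdist_coarse_comm F (iterBlockOf (K - n) x₀) v]
  calc ‖WL2.equiv ℂ _ W₂ (A f) (siteEquiv F K x₀)‖
      = ‖∑ v, WL2.equiv ℂ _ W₂ (A (g v)) (siteEquiv F K x₀)‖ := by rw [hAsum]
    _ ≤ ∑ v, ‖WL2.equiv ℂ _ W₂ (A (g v)) (siteEquiv F K x₀)‖ := norm_sum_le _ _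
    _ ≤ ∑ v, Bblk * Fb * E * Real.exp (-((δ₀ - κ) * (Site.tdist (iterBlockOf (K - n) x₀) v : ℝ))) := Finset.sum_le_sum fun v _ => hterm v
    _ = Bblk * Fb * E * ∑ v, Real.exp (-((δ₀ - κ) * (Site.tdist (iterBlockOf (K - n) x₀) v : ℝ))) := by rw [Finset.mul_sum]
    _ ≤ Bblk * Fb * E * (2 * (1 + 1 / (δ₀ - κ))) ^ 3 := mul_le_mul_of_nonneg_left hrow (by positivity)
    _ = _ := by ring

/-! ## §3 VAL-κ: the LOD propagator `G_a` -/

include hε₀ hε7 hreg hseq hι hT ha in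
-- HEARTBEAT rule (README): the three `set` abstractions over V4g's displayed constant measure ≈ 150k; budgeted decl-locally.
set_option maxHeartbeats 400000 in
/-- ★★ **THE ONE-BLOCK LETTER OF `G_a` AT ONE RATE** — V4g ✓`norm_equiv_massiveSolution_apply_le_decay` with its two rates `κ₀ = min μ ¼`, `κ₀∕2` merged into `κ₀∕2` and the block
`L²` size `‖g‖ ≤ √(c₀(L^d)^{K−n})·G_b` inserted: for `g ⊂ B(v)`, `‖g(x)‖ ≤ G_b`: `‖(G_a g)(x₀)‖ ≤ B_∞^{blk}·G_b·e^{−(κ₀∕2)·tdist(B x₀, v)}`, `B_∞^{blk}` displayed (K-free at the pin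
`c₁ = c₀ℓ³`). [cite: Balaban1985BackgroundPropagators, Thm 3.1 (3.42) p.397, (3.45)–(3.46) p.398] -/
theorem blockLetter_massiveSolution_of_regPr
    (G : SiteL2K ℂ 3 (periodsT3 F K) c₀ W₂ →ₗ[ℂ] SiteL2K ℂ 3 (periodsT3 F K) c₀ W₂)
    (hAG : ∀ f, covLapSite F n K c₀ U₀ (G f) + (a : ℂ) • T (ι (Q'' (G f))) = f)
    {μ : ℝ} (hμ : 0 < μ) {δ₁ : ℝ} (hδ₁ : 0 ≤ δ₁)
    (hδ : 3 * ((eta F n K)⁻¹) ^ 2 * (Real.exp (μ * eta F n K) - 1) ^ 2 + a * ((25 / 8) * (c₁ * ((((F.P K).L : ℝ) ^ (F.P K).d) ^ (K - n))⁻¹ / c₀)) * (Real.exp (3 * μ) - 1) ^ 2 ≤ δ₁ ^ 2)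
    (hwin : Real.sqrt (max 2 (16 * c₀ * ((F.L : ℝ) ^ (K - n)) ^ 3 / (a * c₁))) * δ₁ ≤ 1 / 10) :
    ∀ (g : SiteL2K ℂ 3 (periodsT3 F K) c₀ W₂) (v : Site (F.P K) (K - n)), (∀ x, iterBlockOf (K - n) x ≠ v → (toL2S F K c₀).symm g x = 0) →
      ∀ Gb : ℝ, (∀ x : Site (F.P K) 0, ‖WL2.equiv ℂ _ W₂ g (siteEquiv F K x)‖ ≤ Gb) →
        ∀ x₀ : Site (F.P K) 0, ‖WL2.equiv ℂ _ W₂ (G g) (siteEquiv F K x₀)‖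
          ≤ ((14 * (8 * Real.exp (3 * min μ (1 / 4)) * (1 + Real.exp (3 * μ) * ((a * ((5 / 4) * Real.sqrt (2 * c₁) * ((((F.P K).L : ℝ) ^ (F.P K).d) ^ (K - n))⁻¹ / c₀) * Real.sqrt ((25 / 8) * (c₁ * ((((F.P K).L : ℝ) ^ (F.P K).d) ^ (K - n))⁻¹ / c₀))) * ((8 * Real.sqrt (max 2 (16 * c₀ * ((F.L : ℝ) ^ (K - n)) ^ 3 / (a * c₁))) ^ 2) * Real.sqrt (c₀ * ((((F.P K).L : ℝ) ^ (F.P K).d) ^ (K - n))))))))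
              + (Real.sqrt (3 ^ 3 / (c₀ * ((F.L : ℝ) ^ (K - n)) ^ 3) * 8) * (Real.sqrt (8 * Real.exp (3 * min μ (1 / 4)) * Real.exp (6 * μ) * (2 * (1 + 1 / μ)) ^ 3) * ((8 * Real.sqrt (max 2 (16 * c₀ * ((F.L : ℝ) ^ (K - n)) ^ 3 / (a * c₁))) ^ 2) * Real.sqrt (c₀ * ((((F.P K).L : ℝ) ^ (F.P K).d) ^ (K - n)))))))
            * Gb * Real.exp (-(min μ (1 / 4) / 2 * (Site.tdist (iterBlockOf (K - n) x₀) v : ℝ))) := by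
  intro g v hgv Gb hGb x₀
  have hc₀ : 0 < c₀ := Fact.out
  have hc₁ : 0 < c₁ := Fact.out
  have hGb0 : 0 ≤ Gb := (norm_nonneg _).trans (hGb x₀)
  have hκ0 : 0 < min μ (1 / 4) := lt_min hμ (by norm_num)
  have hd0 : (0 : ℝ) ≤ (Site.tdist (iterBlockOf (K - n) x₀) v : ℝ) := Nat.cast_nonneg _
  have hV := norm_equiv_massiveSolution_apply_le_decay F h hε₀ hε7 U₀ hreg Q'' hseq ι hι T hT ha G hAG hμ hδ₁ hδ hwin g v hgv hGb x₀
  have hng : ‖g‖ ≤ Real.sqrt (c₀ * ((((F.P K).L : ℝ) ^ (F.P K).d) ^ (K - n))) * Gb := norm_le_of_blockSupport F g v hgv hGb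
  set S : ℝ := Real.sqrt (c₀ * ((((F.P K).L : ℝ) ^ (F.P K).d) ^ (K - n))) with hS
  set P : ℝ := a * ((5 / 4) * Real.sqrt (2 * c₁) * ((((F.P K).L : ℝ) ^ (F.P K).d) ^ (K - n))⁻¹ / c₀) * Real.sqrt ((25 / 8) * (c₁ * ((((F.P K).L : ℝ) ^ (F.P K).d) ^ (K - n))⁻¹ / c₀)) with hP
  set M : ℝ := 8 * Real.sqrt (max 2 (16 * c₀ * ((F.L : ℝ) ^ (K - n)) ^ 3 / (a * c₁))) ^ 2 with hM
  have hP0 : 0 ≤ P := by positivity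
  have hM0 : 0 ≤ M := by positivity
  set C₁ : ℝ := 14 * (8 * Real.exp (3 * min μ (1 / 4)) * (1 + Real.exp (3 * μ) * (P * (M * S)))) with hC₁
  set C₂ : ℝ := Real.sqrt (3 ^ 3 / (c₀ * ((F.L : ℝ) ^ (K - n)) ^ 3) * 8) * (Real.sqrt (8 * Real.exp (3 * min μ (1 / 4)) * Real.exp (6 * μ) * (2 * (1 + 1 / μ)) ^ 3) * (M * S)) with hC₂
  have hC₁0 : 0 ≤ C₁ := by positivity
  have hC₂0 : 0 ≤ C₂ := by positivity
  have he1 : Real.exp (-(min μ (1 / 4) * (Site.tdist (iterBlockOf (K - n) x₀) v : ℝ)))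
      ≤ Real.exp (-(min μ (1 / 4) / 2 * (Site.tdist (iterBlockOf (K - n) x₀) v : ℝ))) :=
    Real.exp_le_exp.mpr (by nlinarith [hκ0.le, hd0])
  have h1 : 14 * (8 * Real.exp (3 * min μ (1 / 4)) * (Gb + Real.exp (3 * μ) * (P * (M * ‖g‖)))) ≤ C₁ * Gb := by
    have h1' : 14 * (8 * Real.exp (3 * min μ (1 / 4)) * (Gb + Real.exp (3 * μ) * (P * (M * ‖g‖))))
        ≤ 14 * (8 * Real.exp (3 * min μ (1 / 4)) * (Gb + Real.exp (3 * μ) * (P * (M * (S * Gb))))) := by gcongr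
    refine h1'.trans (le_of_eq ?_)
    rw [hC₁]; ring
  have h2 : Real.sqrt (3 ^ 3 / (c₀ * ((F.L : ℝ) ^ (K - n)) ^ 3) * 8) * (Real.sqrt (8 * Real.exp (3 * min μ (1 / 4)) * Real.exp (6 * μ) * (2 * (1 + 1 / μ)) ^ 3) * (M * ‖g‖)) ≤ C₂ * Gb := by
    have h2' : Real.sqrt (3 ^ 3 / (c₀ * ((F.L : ℝ) ^ (K - n)) ^ 3) * 8) * (Real.sqrt (8 * Real.exp (3 * min μ (1 / 4)) * Real.exp (6 * μ) * (2 * (1 + 1 / μ)) ^ 3) * (M * ‖g‖))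
        ≤ Real.sqrt (3 ^ 3 / (c₀ * ((F.L : ℝ) ^ (K - n)) ^ 3) * 8) * (Real.sqrt (8 * Real.exp (3 * min μ (1 / 4)) * Real.exp (6 * μ) * (2 * (1 + 1 / μ)) ^ 3) * (M * (S * Gb))) := by gcongr
    refine h2'.trans (le_of_eq ?_)
    rw [hC₂]; ring
  calc _ ≤ _ := hV
    _ ≤ C₁ * Gb * Real.exp (-(min μ (1 / 4) / 2 * (Site.tdist (iterBlockOf (K - n) x₀) v : ℝ)))
        + C₂ * Gb * Real.exp (-(min μ (1 / 4) / 2 * (Site.tdist (iterBlockOf (K - n) x₀) v : ℝ))) :=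
        add_le_add (mul_le_mul h1 he1 (Real.exp_pos _).le (mul_nonneg hC₁0 hGb0)) (mul_le_mul_of_nonneg_right h2 (Real.exp_pos _).le)
    _ = _ := by rw [hC₁, hC₂]; ring

include hε₀ hε7 hreg hseq hι hT ha in
/-- ★★★ **VAL-κ — `G_a` PRESERVES A BLOCK-DISTANCE WEIGHT** ([Balaban1985BackgroundPropagators] Thm 3.1 (3.42) read on weighted sources): under `RegPr F n K ε₀ U₀`, the LOD letters
and V4g's Agmon window at slope `μ > 0`, for every `0 ≤ κ < (min μ ¼)∕2`, every source with `‖f(x)‖ ≤ F_b·e^{−κ·tdist(B x, z)}` and every `x`: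
`‖(G_a f)(x)‖ ≤ B_∞^{blk}·(2(1 + 1∕((min μ ¼)∕2 − κ)))³·F_b·e^{−κ·tdist(B x, z)}` — §2 at the one-block letter of `blockLetter_massiveSolution_of_regPr`.
[cite: Balaban1985BackgroundPropagators, Thm 3.1 (3.42) p.397, (3.46) p.398] -/
theorem hGsupW_of_regPr
    (G : SiteL2K ℂ 3 (periodsT3 F K) c₀ W₂ →ₗ[ℂ] SiteL2K ℂ 3 (periodsT3 F K) c₀ W₂)
    (hAG : ∀ f, covLapSite F n K c₀ U₀ (G f) + (a : ℂ) • T (ι (Q'' (G f))) = f)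
    {μ : ℝ} (hμ : 0 < μ) {δ₁ : ℝ} (hδ₁ : 0 ≤ δ₁)
    (hδ : 3 * ((eta F n K)⁻¹) ^ 2 * (Real.exp (μ * eta F n K) - 1) ^ 2 + a * ((25 / 8) * (c₁ * ((((F.P K).L : ℝ) ^ (F.P K).d) ^ (K - n))⁻¹ / c₀)) * (Real.exp (3 * μ) - 1) ^ 2 ≤ δ₁ ^ 2)
    (hwin : Real.sqrt (max 2 (16 * c₀ * ((F.L : ℝ) ^ (K - n)) ^ 3 / (a * c₁))) * δ₁ ≤ 1 / 10)
    {κ : ℝ} (hκ : 0 ≤ κ) (hκμ : κ < min μ (1 / 4) / 2) :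
    ∀ (f : SiteL2K ℂ 3 (periodsT3 F K) c₀ W₂) (z : Site (F.P K) (K - n)) (Fb : ℝ),
      (∀ x : Site (F.P K) 0, ‖WL2.equiv ℂ _ W₂ f (siteEquiv F K x)‖ ≤ Fb * Real.exp (-(κ * (Site.tdist (iterBlockOf (K - n) x) z : ℝ)))) →
      ∀ x : Site (F.P K) 0, ‖WL2.equiv ℂ _ W₂ (G f) (siteEquiv F K x)‖
        ≤ ((14 * (8 * Real.exp (3 * min μ (1 / 4)) * (1 + Real.exp (3 * μ) * ((a * ((5 / 4) * Real.sqrt (2 * c₁) * ((((F.P K).L : ℝ) ^ (F.P K).d) ^ (K - n))⁻¹ / c₀) * Real.sqrt ((25 / 8) * (c₁ * ((((F.P K).L : ℝ) ^ (F.P K).d) ^ (K - n))⁻¹ / c₀))) * ((8 * Real.sqrt (max 2 (16 * c₀ * ((F.L : ℝ) ^ (K - n)) ^ 3 / (a * c₁))) ^ 2) * Real.sqrt (c₀ * ((((F.P K).L : ℝ) ^ (F.P K).d) ^ (K - n))))))))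
              + (Real.sqrt (3 ^ 3 / (c₀ * ((F.L : ℝ) ^ (K - n)) ^ 3) * 8) * (Real.sqrt (8 * Real.exp (3 * min μ (1 / 4)) * Real.exp (6 * μ) * (2 * (1 + 1 / μ)) ^ 3) * ((8 * Real.sqrt (max 2 (16 * c₀ * ((F.L : ℝ) ^ (K - n)) ^ 3 / (a * c₁))) ^ 2) * Real.sqrt (c₀ * ((((F.P K).L : ℝ) ^ (F.P K).d) ^ (K - n)))))))
            * (2 * (1 + 1 / (min μ (1 / 4) / 2 - κ))) ^ 3 * Fb * Real.exp (-(κ * (Site.tdist (iterBlockOf (K - n) x) z : ℝ))) := by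
  intro f z Fb hf x
  have hc₀ : 0 < c₀ := Fact.out
  have hc₁ : 0 < c₁ := Fact.out
  exact norm_equiv_apply_le_of_blockLetter F G (by positivity) hκ hκμ
    (blockLetter_massiveSolution_of_regPr F h hε₀ hε7 U₀ hreg Q'' hseq ι hι T hT ha G hAG hμ hδ₁ hδ hwin) f z hf x

/-! ## §4 PEN-κ: the penalty `a·T(ι(Q″(G_a ·)))` -/

include hε₀ hε7 hreg hseq hι hT ha in
/-- ★★ **THE ONE-BLOCK LETTER OF THE PENALTY AT RATE `μ`** — V4g ✓`norm_equiv_penalty_solution_le` (`e^{−μ(d − 3)} = e^{3μ}e^{−μd}`) with the block `L²` size inserted: for `g ⊂ B(v)`,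
`‖g(x)‖ ≤ G_b`: `‖(a·T(ι(Q″(G_a g))))(x₀)‖ ≤ p_∞^{blk}·G_b·e^{−μ·tdist(B x₀, v)}`. [cite: Balaban1985BackgroundPropagators, (3.24) p.394, Thm 3.1 (3.42) p.397] -/
theorem blockLetter_penalty_of_regPr
    (G : SiteL2K ℂ 3 (periodsT3 F K) c₀ W₂ →ₗ[ℂ] SiteL2K ℂ 3 (periodsT3 F K) c₀ W₂)
    (hAG : ∀ f, covLapSite F n K c₀ U₀ (G f) + (a : ℂ) • T (ι (Q'' (G f))) = f)
    {μ : ℝ} (hμ : 0 < μ) {δ₁ : ℝ} (hδ₁ : 0 ≤ δ₁)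
    (hδ : 3 * ((eta F n K)⁻¹) ^ 2 * (Real.exp (μ * eta F n K) - 1) ^ 2 + a * ((25 / 8) * (c₁ * ((((F.P K).L : ℝ) ^ (F.P K).d) ^ (K - n))⁻¹ / c₀)) * (Real.exp (3 * μ) - 1) ^ 2 ≤ δ₁ ^ 2)
    (hwin : Real.sqrt (max 2 (16 * c₀ * ((F.L : ℝ) ^ (K - n)) ^ 3 / (a * c₁))) * δ₁ ≤ 1 / 10) :
    ∀ (g : SiteL2K ℂ 3 (periodsT3 F K) c₀ W₂) (v : Site (F.P K) (K - n)), (∀ x, iterBlockOf (K - n) x ≠ v → (toL2S F K c₀).symm g x = 0) →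
      ∀ Gb : ℝ, (∀ x : Site (F.P K) 0, ‖WL2.equiv ℂ _ W₂ g (siteEquiv F K x)‖ ≤ Gb) →
        ∀ x₀ : Site (F.P K) 0, ‖WL2.equiv ℂ _ W₂ ((a : ℂ) • T (ι (Q'' (G g)))) (siteEquiv F K x₀)‖
          ≤ (a * ((5 / 4) * Real.sqrt (2 * c₁) * ((((F.P K).L : ℝ) ^ (F.P K).d) ^ (K - n))⁻¹ / c₀) *
              Real.sqrt ((25 / 8) * (c₁ * ((((F.P K).L : ℝ) ^ (F.P K).d) ^ (K - n))⁻¹ / c₀)) *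
              (Real.exp (3 * μ) * (8 * Real.sqrt (max 2 (16 * c₀ * ((F.L : ℝ) ^ (K - n)) ^ 3 / (a * c₁))) ^ 2) * Real.sqrt (c₀ * ((((F.P K).L : ℝ) ^ (F.P K).d) ^ (K - n)))))
            * Gb * Real.exp (-(μ * (Site.tdist (iterBlockOf (K - n) x₀) v : ℝ))) := by
  intro g v hgv Gb hGb x₀
  have hc₀ : 0 < c₀ := Fact.out
  have hc₁ : 0 < c₁ := Fact.out
  have hGb0 : 0 ≤ Gb := (norm_nonneg _).trans (hGb x₀)
  have hV := norm_equiv_penalty_solution_le F h hε₀ hε7 U₀ hreg Q'' hseq ι hι T hT ha G hAG hμ.le hδ₁ hδ hwin g v hgv x₀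
  have hng : ‖g‖ ≤ Real.sqrt (c₀ * ((((F.P K).L : ℝ) ^ (F.P K).d) ^ (K - n))) * Gb := norm_le_of_blockSupport F g v hgv hGb
  set S : ℝ := Real.sqrt (c₀ * ((((F.P K).L : ℝ) ^ (F.P K).d) ^ (K - n))) with hS
  set P : ℝ := a * ((5 / 4) * Real.sqrt (2 * c₁) * ((((F.P K).L : ℝ) ^ (F.P K).d) ^ (K - n))⁻¹ / c₀) * Real.sqrt ((25 / 8) * (c₁ * ((((F.P K).L : ℝ) ^ (F.P K).d) ^ (K - n))⁻¹ / c₀)) with hP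
  set M : ℝ := 8 * Real.sqrt (max 2 (16 * c₀ * ((F.L : ℝ) ^ (K - n)) ^ 3 / (a * c₁))) ^ 2 with hM
  have hP0 : 0 ≤ P := by positivity
  have hM0 : 0 ≤ M := by positivity
  have he : Real.exp (-(μ * ((Site.tdist (iterBlockOf (K - n) x₀) v : ℝ) - 3)))
      = Real.exp (3 * μ) * Real.exp (-(μ * (Site.tdist (iterBlockOf (K - n) x₀) v : ℝ))) := by
    rw [← Real.exp_add]; congr 1; ring
  calc _ ≤ P * (Real.exp (-(μ * ((Site.tdist (iterBlockOf (K - n) x₀) v : ℝ) - 3))) * M * ‖g‖) := hV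
    _ = P * (Real.exp (3 * μ) * M) * ‖g‖ * Real.exp (-(μ * (Site.tdist (iterBlockOf (K - n) x₀) v : ℝ))) := by rw [he]; ring
    _ ≤ P * (Real.exp (3 * μ) * M) * (S * Gb) * Real.exp (-(μ * (Site.tdist (iterBlockOf (K - n) x₀) v : ℝ))) := by gcongr
    _ = _ := by ring

include hε₀ hε7 hreg hseq hι hT ha in
/-- ★★★ **PEN-κ — THE PENALTY PRESERVES A BLOCK-DISTANCE WEIGHT**: under the same letters, for every `0 ≤ κ < μ`, every source with `‖f(x)‖ ≤ F_b·e^{−κ·tdist(B x, z)}` and every `x`: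
`‖(a·T(ι(Q″(G_a f))))(x)‖ ≤ p_∞^{blk}·(2(1 + 1∕(μ − κ)))³·F_b·e^{−κ·tdist(B x, z)}` — §2 at the linear map `u ↦ a·T(ι(Q″(G_a u)))` and the one-block letter of
`blockLetter_penalty_of_regPr`. [cite: Balaban1985BackgroundPropagators, (3.24) p.394, Thm 3.1 (3.42) p.397] -/
theorem hpenW_of_regPr
    (G : SiteL2K ℂ 3 (periodsT3 F K) c₀ W₂ →ₗ[ℂ] SiteL2K ℂ 3 (periodsT3 F K) c₀ W₂)
    (hAG : ∀ f, covLapSite F n K c₀ U₀ (G f) + (a : ℂ) • T (ι (Q'' (G f))) = f)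
    {μ : ℝ} (hμ : 0 < μ) {δ₁ : ℝ} (hδ₁ : 0 ≤ δ₁)
    (hδ : 3 * ((eta F n K)⁻¹) ^ 2 * (Real.exp (μ * eta F n K) - 1) ^ 2 + a * ((25 / 8) * (c₁ * ((((F.P K).L : ℝ) ^ (F.P K).d) ^ (K - n))⁻¹ / c₀)) * (Real.exp (3 * μ) - 1) ^ 2 ≤ δ₁ ^ 2)
    (hwin : Real.sqrt (max 2 (16 * c₀ * ((F.L : ℝ) ^ (K - n)) ^ 3 / (a * c₁))) * δ₁ ≤ 1 / 10)
    {κ : ℝ} (hκ : 0 ≤ κ) (hκμ : κ < μ) :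
    ∀ (f : SiteL2K ℂ 3 (periodsT3 F K) c₀ W₂) (z : Site (F.P K) (K - n)) (Fb : ℝ),
      (∀ x : Site (F.P K) 0, ‖WL2.equiv ℂ _ W₂ f (siteEquiv F K x)‖ ≤ Fb * Real.exp (-(κ * (Site.tdist (iterBlockOf (K - n) x) z : ℝ)))) →
      ∀ x : Site (F.P K) 0, ‖WL2.equiv ℂ _ W₂ ((a : ℂ) • T (ι (Q'' (G f)))) (siteEquiv F K x)‖
        ≤ (a * ((5 / 4) * Real.sqrt (2 * c₁) * ((((F.P K).L : ℝ) ^ (F.P K).d) ^ (K - n))⁻¹ / c₀) *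
              Real.sqrt ((25 / 8) * (c₁ * ((((F.P K).L : ℝ) ^ (F.P K).d) ^ (K - n))⁻¹ / c₀)) *
              (Real.exp (3 * μ) * (8 * Real.sqrt (max 2 (16 * c₀ * ((F.L : ℝ) ^ (K - n)) ^ 3 / (a * c₁))) ^ 2) * Real.sqrt (c₀ * ((((F.P K).L : ℝ) ^ (F.P K).d) ^ (K - n)))))
            * (2 * (1 + 1 / (μ - κ))) ^ 3 * Fb * Real.exp (-(κ * (Site.tdist (iterBlockOf (K - n) x) z : ℝ))) := by
  intro f z Fb hf x
  have hc₀ : 0 < c₀ := Fact.out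
  have hc₁ : 0 < c₁ := Fact.out
  -- the penalty map is linear
  set Lp : SiteL2K ℂ 3 (periodsT3 F K) c₀ W₂ →ₗ[ℂ] SiteL2K ℂ 3 (periodsT3 F K) c₀ W₂ := (a : ℂ) • (T ∘ₗ ι ∘ₗ Q'' ∘ₗ G) with hLp
  have hLp_apply : ∀ u, Lp u = (a : ℂ) • T (ι (Q'' (G u))) := fun u => rfl
  have hblk : ∀ (g : SiteL2K ℂ 3 (periodsT3 F K) c₀ W₂) (v : Site (F.P K) (K - n)), (∀ x, iterBlockOf (K - n) x ≠ v → (toL2S F K c₀).symm g x = 0) →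
      ∀ Gb : ℝ, (∀ x : Site (F.P K) 0, ‖WL2.equiv ℂ _ W₂ g (siteEquiv F K x)‖ ≤ Gb) →
        ∀ x₀ : Site (F.P K) 0, ‖WL2.equiv ℂ _ W₂ (Lp g) (siteEquiv F K x₀)‖
          ≤ (a * ((5 / 4) * Real.sqrt (2 * c₁) * ((((F.P K).L : ℝ) ^ (F.P K).d) ^ (K - n))⁻¹ / c₀) *
              Real.sqrt ((25 / 8) * (c₁ * ((((F.P K).L : ℝ) ^ (F.P K).d) ^ (K - n))⁻¹ / c₀)) *
              (Real.exp (3 * μ) * (8 * Real.sqrt (max 2 (16 * c₀ * ((F.L : ℝ) ^ (K - n)) ^ 3 / (a * c₁))) ^ 2) * Real.sqrt (c₀ * ((((F.P K).L : ℝ) ^ (F.P K).d) ^ (K - n)))))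
            * Gb * Real.exp (-(μ * (Site.tdist (iterBlockOf (K - n) x₀) v : ℝ))) := by
    intro g v hgv Gb hGb x₀
    rw [hLp_apply]
    exact blockLetter_penalty_of_regPr F h hε₀ hε7 U₀ hreg Q'' hseq ι hι T hT ha G hAG hμ hδ₁ hδ hwin g v hgv Gb hGb x₀
  have hmain := norm_equiv_apply_le_of_blockLetter F Lp (by positivity) hκ hκμ hblk f z hf x
  rwa [hLp_apply] at hmain

end Summit.QuantumFields.YangMills.Theorems.Prop7BlockConvolutionWeightedSup

end
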